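import Mathlib
import Literature.Geometry.Symplectic.JHolomorphicMap
import Summits.SmoothPoincare4.SmoothPoincare4.Theorems.SullivanDualTameOrBrodyR4PencilDefs
import Summits.SmoothPoincare4.SmoothPoincare4.Theorems.SullivanDualTameOrBrodyR4HelperFarDeriv
import Summits.SmoothPoincare4.SmoothPoincare4.Theorems.SullivanDualTameOrBrodyR4ContinuityEstimates

/-!
# The adapted complex frame along a pencil member (crux `TameOrBrodyR4`, stmt-SmoothPoincare4-7826, line `Sketch`, stub `helper_memberFrame`)

Given a normalised member `u₀` and (hypothesis `htriv`) a smooth complex trivialisation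
`Ψ₀ ξ : (ℝ⁴, I₀) → (ℝ⁴, J (u₀ ξ))`, `I₀ v = eP (i P v) + eQ (i Q v)`, equal to `id` far out, we
build the ADAPTED FRAME `Ψ ξ : ℂ² → ℝ⁴` (complex linear, first column `du₀(ξ)`, standard far out,
smooth two-sided inverse, global bounds). In the trivialisation the tangent vector has complex
coordinates `t ξ := (P, Q) (Ψ₀inv ξ (du₀(ξ) 1)) ≠ 0` (`u₀` is immersed); far out `Ψ₀ = id` and
`P ∘ u₀`, `Q ∘ u₀` are holomorphic and normalised, so `t = ((P ∘ u₀)′, (Q ∘ u₀)′)` with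
`|t₁ - 1| < 1/2`, `|t₂| < 1/2` (`helper_farDeriv`). With the second column
`n := β (-conj t₂, conj t₁) + (1 - β) (0, 1)` (`β` a smooth bump, `1` on the disc of radius `ρ₀`,
`0` outside radius `ρ₀ + 1`; complex determinant `β |t|² + (1 - β) t₁ ≠ 0`) we set
`Ψ ξ y := Ψ₀ ξ (eP z₁ + eQ z₂)`, `z = y₁ t + y₂ n`; its first column is `du₀(ξ) y₁` by flatness.
-/

-- the registered namespace `Summit.SmoothPoincare4.SmoothPoincare4.…` repeats a component
set_option linter.dupNamespace false

noncomputable section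

open scoped ContDiff Topology
open Filter Set Metric Literature.Geometry.Symplectic

namespace Summit.SmoothPoincare4.SmoothPoincare4.Cruxes.TameOrBrodyR4.Sketch

/-- Local notation for the model space `ℝ⁴ = EuclideanSpace ℝ (Fin 4)`. -/
local notation "E4" => EuclideanSpace ℝ (Fin 4)

namespace MemberFrame

/-- The real-linear endomorphism of `ℂ × ℂ` given by the complex matrix with rows `(a, b)`,
`(c, d)`: `(z₁, z₂) ↦ (a z₁ + b z₂, c z₁ + d z₂)`. -/
def cmat (a b c d : ℂ) : (ℂ × ℂ) →L[ℝ] (ℂ × ℂ) :=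
  ((a • ContinuousLinearMap.fst ℂ ℂ ℂ + b • ContinuousLinearMap.snd ℂ ℂ ℂ).prod
    (c • ContinuousLinearMap.fst ℂ ℂ ℂ + d • ContinuousLinearMap.snd ℂ ℂ ℂ)).restrictScalars ℝ

/-- Evaluation of `cmat`. -/
@[simp] theorem cmat_apply (a b c d : ℂ) (z : ℂ × ℂ) :
    cmat a b c d z = (a * z.1 + b * z.2, c * z.1 + d * z.2) := rfl

/-- `cmat` is complex linear. -/
theorem cmat_smul (a b c d s : ℂ) (z : ℂ × ℂ) : cmat a b c d (s • z) = s • cmat a b c d z := by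
  refine Prod.ext ?_ ?_ <;> simp only [cmat_apply, Prod.smul_fst, Prod.smul_snd, smul_eq_mul] <;>
    ring

/-- `cmat t₁ n₁ t₂ n₂` is the matrix with columns `t` and `n`. -/
theorem cmat_apply_eq (t n y : ℂ × ℂ) : cmat t.1 n.1 t.2 n.2 y = y.1 • t + y.2 • n := by
  refine Prod.ext ?_ ?_ <;> simp only [cmat_apply, Prod.smul_fst, Prod.smul_snd, Prod.fst_add,
    Prod.snd_add, smul_eq_mul] <;> ring

/-- The inverse matrix (meaningful when `a d - b c ≠ 0`). -/
def cmatInv (a b c d : ℂ) : (ℂ × ℂ) →L[ℝ] (ℂ × ℂ) :=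
  cmat (d * (a * d - b * c)⁻¹) (-b * (a * d - b * c)⁻¹) (-c * (a * d - b * c)⁻¹)
    (a * (a * d - b * c)⁻¹)

/-- `cmatInv` is a two-sided inverse of `cmat`. -/
theorem cmatInv_comp (a b c d : ℂ) (h : a * d - b * c ≠ 0) :
    (cmatInv a b c d).comp (cmat a b c d) = ContinuousLinearMap.id ℝ (ℂ × ℂ) ∧
      (cmat a b c d).comp (cmatInv a b c d) = ContinuousLinearMap.id ℝ (ℂ × ℂ) := by
  have h1 := mul_inv_cancel₀ h
  refine ⟨ContinuousLinearMap.ext fun z => Prod.ext ?_ ?_,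
    ContinuousLinearMap.ext fun z => Prod.ext ?_ ?_⟩ <;>
    simp only [cmatInv, ContinuousLinearMap.comp_apply, cmat_apply, ContinuousLinearMap.id_apply]
  · linear_combination z.1 * h1
  · linear_combination z.2 * h1
  · linear_combination z.1 * h1
  · linear_combination z.2 * h1

/-- `‖a z₁ + b z₂‖ ≤ (‖a‖ + ‖b‖) ‖z‖`. -/
theorem norm_lin_le (a b : ℂ) (z : ℂ × ℂ) : ‖a * z.1 + b * z.2‖ ≤ (‖a‖ + ‖b‖) * ‖z‖ := by
  refine (norm_add_le _ _).trans ?_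
  rw [norm_mul, norm_mul, add_mul]
  exact add_le_add (mul_le_mul_of_nonneg_left (norm_fst_le z) (norm_nonneg a))
    (mul_le_mul_of_nonneg_left (norm_snd_le z) (norm_nonneg b))

/-- Operator-norm bound for `cmat` by the moduli of its entries. -/
theorem norm_cmat_le (a b c d : ℂ) : ‖cmat a b c d‖ ≤ ‖a‖ + ‖b‖ + ‖c‖ + ‖d‖ := by
  refine ContinuousLinearMap.opNorm_le_bound _ (by positivity) fun z => ?_
  rw [cmat_apply, Prod.norm_mk]
  refine max_le ((norm_lin_le a b z).trans ?_) ((norm_lin_le c d z).trans ?_) <;>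
    exact mul_le_mul_of_nonneg_right
      (by linarith [norm_nonneg a, norm_nonneg b, norm_nonneg c, norm_nonneg d]) (norm_nonneg z)

/-- A matrix with smooth entries is a smooth family of real-linear maps. -/
theorem contDiff_cmat {n : WithTop ℕ∞} {a b c d : ℂ → ℂ} (ha : ContDiff ℝ n a)
    (hb : ContDiff ℝ n b) (hc : ContDiff ℝ n c) (hd : ContDiff ℝ n d) :
    ContDiff ℝ n fun x => cmat (a x) (b x) (c x) (d x) := by
  refine contDiff_clm_apply_iff.mpr fun y => ?_
  simp only [cmat_apply]
  exact ((ha.mul contDiff_const).add (hb.mul contDiff_const)).prodMk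
    ((hc.mul contDiff_const).add (hd.mul contDiff_const))

/-- The inverse coordinate map of a frame: `(y₁, y₂) ↦ eP y₁ + eQ y₂`. -/
def frameLinv (eP eQ : ℂ →L[ℝ] E4) : (ℂ × ℂ) →L[ℝ] E4 :=
  eP.comp (ContinuousLinearMap.fst ℝ ℂ ℂ) + eQ.comp (ContinuousLinearMap.snd ℝ ℂ ℂ)

/-- Evaluation of `frameLinv`. -/
@[simp] theorem frameLinv_apply (eP eQ : ℂ →L[ℝ] E4) (y : ℂ × ℂ) :
    frameLinv eP eQ y = eP y.1 + eQ y.2 := rfl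

variable {P Q : E4 →L[ℝ] ℂ} {eP eQ : ℂ →L[ℝ] E4}

/-- The coordinates of `frameLinv y` are `y`. -/
theorem PQ_frameLinv (hPQ : IsCoordFrame P Q eP eQ) (y : ℂ × ℂ) :
    P (frameLinv eP eQ y) = y.1 ∧ Q (frameLinv eP eQ y) = y.2 := by
  rw [frameLinv_apply, map_add, map_add, hPQ.2.1, hPQ.2.2.2.1, add_zero, hPQ.2.2.1,
    hPQ.2.2.2.2.1, zero_add]
  exact ⟨rfl, rfl⟩

/-- `frameLinv` intertwines `i` on `ℂ × ℂ` with `I₀ v = eP (i P v) + eQ (i Q v)`. -/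
theorem frameLinv_I_smul (hPQ : IsCoordFrame P Q eP eQ) (y : ℂ × ℂ) :
    frameLinv eP eQ (Complex.I • y) =
      eP (Complex.I * P (frameLinv eP eQ y)) + eQ (Complex.I * Q (frameLinv eP eQ y)) := by
  rw [(PQ_frameLinv hPQ y).1, (PQ_frameLinv hPQ y).2]
  rfl

/-- The adapted frame built from a trivialisation `A`, a tangent column `t` and a second column
`n` (complex coordinates): `y ↦ A (eP z₁ + eQ z₂)`, `z = y₁ t + y₂ n`. -/
def framePsi (eP eQ : ℂ →L[ℝ] E4) (A : E4 →L[ℝ] E4) (t n : ℂ × ℂ) : (ℂ × ℂ) →L[ℝ] E4 :=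
  (A.comp (frameLinv eP eQ)).comp (cmat t.1 n.1 t.2 n.2)

/-- The inverse of the adapted frame. -/
def framePsiInv (P Q : E4 →L[ℝ] ℂ) (Ainv : E4 →L[ℝ] E4) (t n : ℂ × ℂ) : E4 →L[ℝ] (ℂ × ℂ) :=
  (cmatInv t.1 n.1 t.2 n.2).comp ((P.prod Q).comp Ainv)

/-- Evaluation of `framePsi`. -/
theorem framePsi_apply' (eP eQ : ℂ →L[ℝ] E4) (A : E4 →L[ℝ] E4) (t n y : ℂ × ℂ) :
    framePsi eP eQ A t n y = A (frameLinv eP eQ (cmat t.1 n.1 t.2 n.2 y)) := rfl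

/-- `framePsiInv` is a two-sided inverse of `framePsi`. -/
theorem framePsiInv_comp (hPQ : IsCoordFrame P Q eP eQ) {A Ainv : E4 →L[ℝ] E4}
    (hA₁ : Ainv.comp A = ContinuousLinearMap.id ℝ E4)
    (hA₂ : A.comp Ainv = ContinuousLinearMap.id ℝ E4) {t n : ℂ × ℂ}
    (hdet : t.1 * n.2 - n.1 * t.2 ≠ 0) :
    (framePsiInv P Q Ainv t n).comp (framePsi eP eQ A t n) = ContinuousLinearMap.id ℝ (ℂ × ℂ) ∧
      (framePsi eP eQ A t n).comp (framePsiInv P Q Ainv t n) = ContinuousLinearMap.id ℝ E4 := by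
  obtain ⟨h₁, h₂⟩ := cmatInv_comp t.1 n.1 t.2 n.2 hdet
  have hA₁' : ∀ v, Ainv (A v) = v := fun v => DFunLike.congr_fun hA₁ v
  refine ⟨ContinuousLinearMap.ext fun y => ?_, ContinuousLinearMap.ext fun x => ?_⟩
  · show cmatInv t.1 n.1 t.2 n.2
      ((P.prod Q) (Ainv (A (frameLinv eP eQ (cmat t.1 n.1 t.2 n.2 y))))) = y
    rw [hA₁', ContinuousLinearMap.prod_apply, (PQ_frameLinv hPQ _).1, (PQ_frameLinv hPQ _).2,
      Prod.mk.eta]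
    exact DFunLike.congr_fun h₁ y
  · have hx : cmat t.1 n.1 t.2 n.2 (cmatInv t.1 n.1 t.2 n.2 ((P.prod Q) (Ainv x))) =
        (P.prod Q) (Ainv x) := DFunLike.congr_fun h₂ _
    show A (frameLinv eP eQ (cmat t.1 n.1 t.2 n.2
      (cmatInv t.1 n.1 t.2 n.2 ((P.prod Q) (Ainv x))))) = x
    rw [hx]
    exact (congrArg A (hPQ.2.2.2.2.2 (Ainv x))).trans (DFunLike.congr_fun hA₂ x)

/-- `framePsi` is complex linear for `i` on `ℂ × ℂ` and `Jx` on `ℝ⁴`, as soon as `A` is. -/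
theorem framePsi_I_smul (hPQ : IsCoordFrame P Q eP eQ) {A Jx : E4 →L[ℝ] E4}
    (hAJ : ∀ v, A (eP (Complex.I * P v) + eQ (Complex.I * Q v)) = Jx (A v)) (t n y : ℂ × ℂ) :
    framePsi eP eQ A t n (Complex.I • y) = Jx (framePsi eP eQ A t n y) := by
  rw [framePsi_apply', framePsi_apply', cmat_smul, frameLinv_I_smul hPQ]
  exact hAJ _

/-- **Evaluation of the adapted frame.** If `t` are the complex coordinates of `Ainv (D 1)` for a
`Jx`-complex-linear `D`, then `framePsi y = D y₁ + A (eP (y₂ n₁) + eQ (y₂ n₂))`: the first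
column is `y₁ ·_{Jx} D 1 = D y₁`. -/
theorem framePsi_apply (hPQ : IsCoordFrame P Q eP eQ) {A Ainv Jx : E4 →L[ℝ] E4}
    (hA : A.comp Ainv = ContinuousLinearMap.id ℝ E4)
    (hAJ : ∀ v, A (eP (Complex.I * P v) + eQ (Complex.I * Q v)) = Jx (A v))
    (D : ℂ →L[ℝ] E4) (hD : D (Complex.I * 1) = Jx (D 1)) {t : ℂ × ℂ}
    (ht : t = (P (Ainv (D 1)), Q (Ainv (D 1)))) (n y : ℂ × ℂ) :
    framePsi eP eQ A t n y = D y.1 + A (eP (y.2 * n.1) + eQ (y.2 * n.2)) := by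
  have h1 : A (frameLinv eP eQ t) = D 1 := by
    rw [ht]
    exact (congrArg A (hPQ.2.2.2.2.2 (Ainv (D 1)))).trans (DFunLike.congr_fun hA (D 1))
  have h2 : A (frameLinv eP eQ (Complex.I • t)) = D Complex.I := by
    rw [frameLinv_I_smul hPQ, hAJ, h1, ← hD, mul_one]
  have hdec : y.1 • t = (y.1.re : ℝ) • t + (y.1.im : ℝ) • (Complex.I • t) := by
    refine Prod.ext ?_ ?_ <;> simp only [Prod.smul_fst, Prod.fst_add, Prod.smul_snd,
      Prod.snd_add, smul_eq_mul, Complex.real_smul]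
    · linear_combination (-t.1) * Complex.re_add_im y.1
    · linear_combination (-t.2) * Complex.re_add_im y.1
  have key : A (frameLinv eP eQ (y.1 • t)) = D y.1 :=
    calc A (frameLinv eP eQ (y.1 • t))
        = (y.1.re : ℝ) • A (frameLinv eP eQ t) +
            (y.1.im : ℝ) • A (frameLinv eP eQ (Complex.I • t)) := by
          rw [hdec, map_add, map_add, map_smul, map_smul, map_smul, map_smul]
      _ = D ((y.1.re : ℝ) • (1 : ℂ) + (y.1.im : ℝ) • Complex.I) := by
          rw [h1, h2, map_add, map_smul, map_smul]
      _ = D y.1 := by rw [Complex.real_smul, Complex.real_smul, mul_one, Complex.re_add_im]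
  rw [framePsi_apply', cmat_apply_eq, map_add, map_add, key]
  simp only [frameLinv_apply, Prod.smul_fst, Prod.smul_snd, smul_eq_mul]

/-- Far bounds (`A = Ainv = id`, columns `t`, `(0, 1)` with `|t₁ - 1| < 1/2`, `|t₂| < 1/2`). -/
theorem norm_far_le (P Q : E4 →L[ℝ] ℂ) (eP eQ : ℂ →L[ℝ] E4) (t : ℂ × ℂ)
    (h1 : ‖t.1 - 1‖ < 1 / 2) (h2 : ‖t.2‖ < 1 / 2) :
    ‖framePsi eP eQ (ContinuousLinearMap.id ℝ E4) t (0, 1)‖ ≤ 3 * ‖frameLinv eP eQ‖ ∧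
      ‖framePsiInv P Q (ContinuousLinearMap.id ℝ E4) t (0, 1)‖ ≤ 4 * ‖P.prod Q‖ := by
  have h := abs_le.mp (abs_norm_sub_norm_le t.1 1)
  rw [norm_one] at h
  have ht0 : 0 < ‖t.1‖ := by linarith
  have hinv : ‖t.1⁻¹‖ ≤ 2 := by
    rw [norm_inv]
    exact (inv_anti₀ (by norm_num) (by linarith : 1 / 2 ≤ ‖t.1‖)).trans_eq (by norm_num)
  have hM : ‖cmat t.1 0 t.2 1‖ ≤ 3 := by
    refine (norm_cmat_le _ _ _ _).trans ?_
    rw [norm_zero, norm_one]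
    linarith
  have hMinv : ‖cmatInv t.1 0 t.2 1‖ ≤ 4 := by
    rw [show cmatInv t.1 0 t.2 1 = cmat t.1⁻¹ 0 (-t.2 * t.1⁻¹) (t.1 * t.1⁻¹) by
      simp only [cmatInv, mul_one, zero_mul, sub_zero, neg_zero, one_mul]]
    refine (norm_cmat_le _ _ _ _).trans ?_
    rw [mul_inv_cancel₀ (norm_pos_iff.mp ht0), norm_one, norm_zero, norm_mul, norm_neg]
    nlinarith [mul_le_mul h2.le hinv (norm_nonneg _) (by norm_num : (0 : ℝ) ≤ 1 / 2)]
  constructor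
  · calc ‖framePsi eP eQ (ContinuousLinearMap.id ℝ E4) t (0, 1)‖
        ≤ ‖(ContinuousLinearMap.id ℝ E4).comp (frameLinv eP eQ)‖ * ‖cmat t.1 0 t.2 1‖ :=
          ContinuousLinearMap.opNorm_comp_le _ _
      _ ≤ ‖frameLinv eP eQ‖ * 3 := by
          rw [ContinuousLinearMap.id_comp]
          exact mul_le_mul_of_nonneg_left hM (norm_nonneg _)
      _ = 3 * ‖frameLinv eP eQ‖ := mul_comm _ _
  · calc ‖framePsiInv P Q (ContinuousLinearMap.id ℝ E4) t (0, 1)‖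
        ≤ ‖cmatInv t.1 0 t.2 1‖ * ‖(P.prod Q).comp (ContinuousLinearMap.id ℝ E4)‖ :=
          ContinuousLinearMap.opNorm_comp_le _ _
      _ ≤ 4 * ‖P.prod Q‖ := by
          rw [ContinuousLinearMap.comp_id]
          exact mul_le_mul_of_nonneg_right hMinv (norm_nonneg _)

end MemberFrame

open MemberFrame

/-- **Registered helper `helper_memberFrame`: the adapted complex frame along a pencil member.**
Given a normalised member `u₀` and (hypothesis `htriv`) a smooth complex trivialisation
`Ψ₀ ξ : (ℝ⁴, I₀) → (ℝ⁴, J (u₀ ξ))` which is the identity beyond any prescribed radius where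
`|P ∘ u₀| ≥ R`, there is a smooth family of real-linear isomorphisms `Ψ ξ : ℂ × ℂ → ℝ⁴` with
smooth inverses, complex linear (`i ↦ J (u₀ ξ)`), with first column the differential `du₀(ξ)`,
equal far out to the standard frame `(y₁, y₂) ↦ du₀(ξ) y₁ + eQ y₂`, with global bounds. -/
theorem helper_memberFrame (J : E4 → E4 →L[ℝ] E4) (R : ℝ) (P Q : E4 →L[ℝ] ℂ)
    (eP eQ : ℂ →L[ℝ] E4) (hR : 0 < R) (hJs : ContDiff ℝ ∞ J) (hJ2 : ∀ x v, J x (J x v) = -v)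
    (hPQ : IsCoordFrame P Q eP eQ)
    (hJP : ∀ x : E4, R ≤ ‖x‖ → ∀ v, P (J x v) = Complex.I * P v)
    (hJQ : ∀ x : E4, R ≤ ‖x‖ → ∀ v, Q (J x v) = Complex.I * Q v)
    (b₀ : ℂ) (u₀ : ℂ → E4) (hu₀ : IsPencilMember J R P Q b₀ u₀)
    (htriv : ∀ (ρ₀ : ℝ), (∀ ξ : ℂ, ρ₀ ≤ ‖ξ‖ → R ≤ ‖P (u₀ ξ)‖) →
      ∃ (Ψ₀ Ψ₀inv : ℂ → E4 →L[ℝ] E4) (C : ℝ), ContDiff ℝ ∞ Ψ₀ ∧ ContDiff ℝ ∞ Ψ₀inv ∧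
      (∀ ξ, (Ψ₀inv ξ).comp (Ψ₀ ξ) = ContinuousLinearMap.id ℝ E4) ∧
      (∀ ξ, (Ψ₀ ξ).comp (Ψ₀inv ξ) = ContinuousLinearMap.id ℝ E4) ∧
      (∀ ξ v, Ψ₀ ξ (eP (Complex.I * P v) + eQ (Complex.I * Q v)) = J (u₀ ξ) (Ψ₀ ξ v)) ∧
      (∀ ξ, ρ₀ ≤ ‖ξ‖ → Ψ₀ ξ = ContinuousLinearMap.id ℝ E4) ∧
      (∀ ξ, ‖Ψ₀ ξ‖ ≤ C) ∧ (∀ ξ, ‖Ψ₀inv ξ‖ ≤ C)) :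
    ∃ (Ψ : ℂ → (ℂ × ℂ) →L[ℝ] E4) (Ψinv : ℂ → E4 →L[ℝ] (ℂ × ℂ)) (C ρ₁ : ℝ), 0 < ρ₁ ∧
      ContDiff ℝ ∞ Ψ ∧ ContDiff ℝ ∞ Ψinv ∧
      (∀ ξ, (Ψinv ξ).comp (Ψ ξ) = ContinuousLinearMap.id ℝ (ℂ × ℂ)) ∧
      (∀ ξ, (Ψ ξ).comp (Ψinv ξ) = ContinuousLinearMap.id ℝ E4) ∧
      (∀ ξ (y : ℂ × ℂ), Ψ ξ (Complex.I • y) = J (u₀ ξ) (Ψ ξ y)) ∧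
      (∀ ξ (y₁ : ℂ), Ψ ξ (y₁, 0) = fderiv ℝ u₀ ξ y₁) ∧
      (∀ ξ, ρ₁ ≤ ‖ξ‖ → ∀ y : ℂ × ℂ, Ψ ξ y = fderiv ℝ u₀ ξ y.1 + eQ y.2) ∧
      (∀ ξ, ‖Ψ ξ‖ ≤ C) ∧ (∀ ξ, ‖Ψinv ξ‖ ≤ C) ∧
      (∀ ξ, ρ₁ ≤ ‖ξ‖ → R + 1 ≤ ‖P (u₀ ξ)‖) := by
  have _ := And.intro hJs (And.intro hJ2 hR)
  obtain ⟨hu₀s, hu₀J, -, hu₀imm, hQlim, hPlim, -, -⟩ := hu₀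
  -- far facts: `|P ∘ u₀| ≥ R + 1`, holomorphy of the coordinates, derivative estimates
  obtain ⟨ρb, hρb⟩ := FarDeriv.exists_radius_small (fun η => P (u₀ η)) hPlim
  have hfarP : ∀ ξ : ℂ, max ρb (R + 2) ≤ ‖ξ‖ → R + 1 ≤ ‖P (u₀ ξ)‖ := fun ξ hξ => by
    have h1 := hρb ξ ((le_max_left _ _).trans hξ)
    have h2 : ‖ξ‖ - ‖P (u₀ ξ)‖ ≤ ‖P (u₀ ξ) - ξ‖ := norm_sub_rev (P (u₀ ξ)) ξ ▸ norm_sub_norm_le _ _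
    linarith [(le_max_right _ _).trans hξ]
  have hcd : ∀ Lc : E4 →L[ℝ] ℂ, (∀ x : E4, R ≤ ‖x‖ → ∀ v, Lc (J x v) = Complex.I * Lc v) →
      ∀ η : ℂ, max ρb (R + 2) ≤ ‖η‖ → DifferentiableAt ℂ (fun η => Lc (u₀ η)) η :=
    fun Lc hJL η hη => Continuity.differentiableAt_coord Lc hJL hu₀s hu₀J
      (by linarith [hfarP η hη, PencilDefs.norm_P_le hPQ (u₀ η)])
  obtain ⟨ρf, hρcf, hρf0, hρf⟩ := helper_farDeriv (fun η => P (u₀ η)) _ (hcd P hJP) hPlim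
  obtain ⟨ρg, hρcg, -, hρg⟩ := helper_farDeriv (fun η => Q (u₀ η) - b₀ + η) (max ρb (R + 2))
    (fun η hη => ((hcd Q hJQ η hη).sub_const b₀).add differentiableAt_id)
    (by simpa using hQlim.sub_const b₀)
  have hderivq : ∀ η : ℂ, ρg ≤ ‖η‖ → ‖deriv (fun η => Q (u₀ η)) η‖ < 1 / 2 := fun η hη => by
    have hd : deriv (fun η => Q (u₀ η) - b₀ + η) η = deriv (fun η => Q (u₀ η)) η + 1 :=
      (((hcd Q hJQ η (hρcg.trans hη)).hasDerivAt.sub_const b₀).add (hasDerivAt_id' η)).deriv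
    simpa [hd] using hρg η hη
  obtain ⟨ρ₀, hρ₀f, hρ₀g, hρ₀pos⟩ : ∃ ρ₀ : ℝ, ρf ≤ ρ₀ ∧ ρg ≤ ρ₀ ∧ 0 < ρ₀ :=
    ⟨max ρf ρg, le_max_left _ _, le_max_right _ _, lt_max_of_lt_left hρf0⟩
  have hρ₀c : max ρb (R + 2) ≤ ρ₀ := hρcf.trans hρ₀f
  obtain ⟨Ψ₀, Ψ₀inv, -, hΨ₀s, hΨ₀invs, hinv₁, hinv₂, hΨ₀J, hΨ₀far, -, -⟩ :=
    htriv ρ₀ fun ξ hξ => by linarith [hfarP ξ (hρ₀c.trans hξ)]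
  have hΨ₀invfar : ∀ ξ : ℂ, ρ₀ ≤ ‖ξ‖ → Ψ₀inv ξ = ContinuousLinearMap.id ℝ E4 := fun ξ hξ => by
    simpa [hΨ₀far ξ hξ] using hinv₁ ξ
  have hcoord : ∀ (Lc : E4 →L[ℝ] ℂ) (ξ : ℂ), DifferentiableAt ℂ (fun η => Lc (u₀ η)) ξ →
      Lc (fderiv ℝ u₀ ξ 1) = deriv (fun η => Lc (u₀ η)) ξ := fun Lc ξ hdiff => by
    have h := (Lc.hasFDerivAt.comp ξ (hu₀s.differentiable (by simp) ξ).hasFDerivAt).unique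
      (hdiff.hasDerivAt.hasFDerivAt.restrictScalars ℝ)
    simpa using DFunLike.congr_fun h 1
  let β : ContDiffBump (0 : ℂ) := ⟨ρ₀, ρ₀ + 1, hρ₀pos, by linarith⟩
  obtain ⟨t, ht_def⟩ : ∃ t : ℂ → ℂ × ℂ,
      t = fun ξ => (P (Ψ₀inv ξ (fderiv ℝ u₀ ξ 1)), Q (Ψ₀inv ξ (fderiv ℝ u₀ ξ 1))) := ⟨_, rfl⟩
  obtain ⟨nn, hnn_def⟩ : ∃ nn : ℂ → ℂ × ℂ, nn = fun ξ =>
      (-((β ξ : ℝ) : ℂ) * Complex.conjCLE (t ξ).2,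
        ((β ξ : ℝ) : ℂ) * Complex.conjCLE (t ξ).1 + (1 - ((β ξ : ℝ) : ℂ))) := ⟨_, rfl⟩
  have hw : ContDiff ℝ ∞ fun ξ => Ψ₀inv ξ (fderiv ℝ u₀ ξ 1) :=
    hΨ₀invs.clm_apply ((hu₀s.fderiv_right (m := ∞) le_rfl).clm_apply contDiff_const)
  have hts : ContDiff ℝ ∞ t := ht_def ▸ (P.contDiff.comp hw).prodMk (Q.contDiff.comp hw)
  have hβs : ContDiff ℝ ∞ fun ξ => ((β ξ : ℝ) : ℂ) := Complex.ofRealCLM.contDiff.comp β.contDiff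
  have hnns : ContDiff ℝ ∞ nn :=
    hnn_def ▸ (hβs.neg.mul (Complex.conjCLE.contDiff.comp hts.snd)).prodMk
      ((hβs.mul (Complex.conjCLE.contDiff.comp hts.fst)).add (contDiff_const.sub hβs))
  have hdets : ContDiff ℝ ∞ fun ξ => (t ξ).1 * (nn ξ).2 - (nn ξ).1 * (t ξ).2 :=
    (hts.fst.mul hnns.snd).sub (hnns.fst.mul hts.snd)
  -- the tangent column does not vanish (the member is immersed); the columns far out
  have ht_ne : ∀ ξ, t ξ ≠ 0 := fun ξ h0 => by
    simp only [ht_def, Prod.mk_eq_zero] at h0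
    have hw0 : Ψ₀inv ξ (fderiv ℝ u₀ ξ 1) = 0 :=
      PencilDefs.eq_of_apply_eq hPQ (by rw [h0.1, map_zero]) (by rw [h0.2, map_zero])
    have h1 : fderiv ℝ u₀ ξ 1 = 0 := by
      simpa [hw0] using (DFunLike.congr_fun (hinv₂ ξ) (fderiv ℝ u₀ ξ 1)).symm
    exact one_ne_zero (hu₀imm ξ (by rw [h1, map_zero]))
  have htf : ∀ ξ : ℂ, ρ₀ ≤ ‖ξ‖ → ‖(t ξ).1 - 1‖ < 1 / 2 ∧ ‖(t ξ).2‖ < 1 / 2 := fun ξ hξ => by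
    simp only [ht_def]
    rw [hΨ₀invfar ξ hξ, ContinuousLinearMap.id_apply, hcoord P ξ (hcd P hJP ξ (hρ₀c.trans hξ)),
      hcoord Q ξ (hcd Q hJQ ξ (hρ₀c.trans hξ))]
    exact ⟨hρf ξ (hρ₀f.trans hξ), hderivq ξ (hρ₀g.trans hξ)⟩
  have hnn_far : ∀ ξ : ℂ, ρ₀ + 1 ≤ ‖ξ‖ → nn ξ = (0, 1) := fun ξ hξ => by
    simp [hnn_def, β.zero_of_le_dist (show ρ₀ + 1 ≤ dist ξ 0 by rwa [dist_zero_right])]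
  -- the determinant `β |t|² + (1 - β) t₁` does not vanish
  have hdet_ne : ∀ ξ, (t ξ).1 * (nn ξ).2 - (nn ξ).1 * (t ξ).2 ≠ 0 := fun ξ h0 => by
    have hre : ((t ξ).1 * (nn ξ).2 - (nn ξ).1 * (t ξ).2).re =
        β ξ * (Complex.normSq (t ξ).1 + Complex.normSq (t ξ).2) + (1 - β ξ) * (t ξ).1.re := by
      simp only [hnn_def, Complex.conjCLE_apply, Complex.sub_re, Complex.mul_re, Complex.mul_im,
        Complex.add_re, Complex.add_im, Complex.neg_re, Complex.neg_im, Complex.conj_re,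
        Complex.conj_im, Complex.ofReal_re, Complex.ofReal_im, Complex.one_re, Complex.one_im,
        Complex.sub_im, Complex.normSq_apply]
      ring
    rw [h0, Complex.zero_re] at hre
    have hn1 := Complex.normSq_nonneg (t ξ).1
    have hn2 := Complex.normSq_nonneg (t ξ).2
    rcases le_or_gt ‖ξ‖ ρ₀ with hle | hlt
    · rw [β.one_of_mem_closedBall (mem_closedBall_zero_iff.mpr hle)] at hre
      exact ht_ne ξ (Prod.ext (Complex.normSq_eq_zero.mp (by linarith))
        (Complex.normSq_eq_zero.mp (by linarith)))
    · have h1 := Complex.abs_re_le_norm ((t ξ).1 - 1)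
      rw [Complex.sub_re, Complex.one_re] at h1
      have hr : 1 / 2 < (t ξ).1.re := by linarith [(abs_le.mp h1).1, (htf ξ hlt.le).1]
      have hb0 : 0 ≤ β ξ := β.nonneg
      have hsq : (t ξ).1.re ^ 2 ≤ Complex.normSq (t ξ).1 := by
        rw [Complex.normSq_apply]
        nlinarith [sq_nonneg (t ξ).1.im]
      nlinarith [mul_nonneg hb0 hn2, mul_le_mul_of_nonneg_left hsq hb0,
        mul_nonneg hb0 (sq_nonneg ((t ξ).1.re - 1 / 2)), β.le_one (x := ξ)]
  obtain ⟨Ψ, hΨ_def⟩ : ∃ Ψ : ℂ → (ℂ × ℂ) →L[ℝ] E4,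
      Ψ = fun ξ => framePsi eP eQ (Ψ₀ ξ) (t ξ) (nn ξ) := ⟨_, rfl⟩
  obtain ⟨Ψinv, hΨinv_def⟩ : ∃ Ψinv : ℂ → E4 →L[ℝ] (ℂ × ℂ),
      Ψinv = fun ξ => framePsiInv P Q (Ψ₀inv ξ) (t ξ) (nn ξ) := ⟨_, rfl⟩
  have hΨs : ContDiff ℝ ∞ Ψ := by
    rw [hΨ_def]
    unfold framePsi
    exact (hΨ₀s.clm_comp contDiff_const).clm_comp
      (contDiff_cmat hts.fst hnns.fst hts.snd hnns.snd)
  have hΨinvs : ContDiff ℝ ∞ Ψinv := by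
    rw [hΨinv_def]
    unfold framePsiInv cmatInv
    have hδ := hdets.inv hdet_ne
    exact (contDiff_cmat (hnns.snd.mul hδ) (hnns.fst.neg.mul hδ) (hts.snd.neg.mul hδ)
      (hts.fst.mul hδ)).clm_comp (contDiff_const.clm_comp hΨ₀invs)
  have hK := isCompact_closedBall (0 : ℂ) (ρ₀ + 1)
  obtain ⟨B₁, hB₁⟩ := hK.exists_bound_of_continuousOn hΨs.continuous.continuousOn
  obtain ⟨B₂, hB₂⟩ := hK.exists_bound_of_continuousOn hΨinvs.continuous.continuousOn
  have hbd : ∀ ξ : ℂ, ‖Ψ ξ‖ ≤ max (max B₁ B₂) (max (3 * ‖frameLinv eP eQ‖) (4 * ‖P.prod Q‖)) ∧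
      ‖Ψinv ξ‖ ≤ max (max B₁ B₂) (max (3 * ‖frameLinv eP eQ‖) (4 * ‖P.prod Q‖)) := fun ξ => by
    rcases le_or_gt ‖ξ‖ (ρ₀ + 1) with hle | hlt
    · exact ⟨(hB₁ ξ (mem_closedBall_zero_iff.mpr hle)).trans (le_max_of_le_left (le_max_left _ _)),
        (hB₂ ξ (mem_closedBall_zero_iff.mpr hle)).trans (le_max_of_le_left (le_max_right _ _))⟩
    · have h := norm_far_le P Q eP eQ (t ξ) (htf ξ (by linarith)).1 (htf ξ (by linarith)).2
      simp only [hΨ_def, hΨinv_def]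
      rw [hΨ₀far ξ (by linarith), hΨ₀invfar ξ (by linarith), hnn_far ξ hlt.le]
      exact ⟨h.1.trans (le_max_of_le_right (le_max_left _ _)),
        h.2.trans (le_max_of_le_right (le_max_right _ _))⟩
  refine ⟨Ψ, Ψinv, _, ρ₀ + 1, by linarith, hΨs, hΨinvs, ?_, ?_, ?_, ?_, ?_, fun ξ => (hbd ξ).1,
    fun ξ => (hbd ξ).2, fun ξ hξ => hfarP ξ (by linarith)⟩
  · intro ξ
    simp only [hΨ_def, hΨinv_def]
    exact (framePsiInv_comp hPQ (hinv₁ ξ) (hinv₂ ξ) (hdet_ne ξ)).1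
  · intro ξ
    simp only [hΨ_def, hΨinv_def]
    exact (framePsiInv_comp hPQ (hinv₁ ξ) (hinv₂ ξ) (hdet_ne ξ)).2
  · intro ξ y
    simp only [hΨ_def]
    exact framePsi_I_smul hPQ (hΨ₀J ξ) _ _ y
  · intro ξ y₁
    simp only [hΨ_def]
    rw [framePsi_apply hPQ (hinv₂ ξ) (hΨ₀J ξ) (fderiv ℝ u₀ ξ) (hu₀J ξ 1) (congrFun ht_def ξ)]
    simp
  · intro ξ hξ y
    simp only [hΨ_def]
    rw [framePsi_apply hPQ (hinv₂ ξ) (hΨ₀J ξ) (fderiv ℝ u₀ ξ) (hu₀J ξ 1) (congrFun ht_def ξ),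
      hΨ₀far ξ (by linarith), hnn_far ξ hξ]
    simp

end Summit.SmoothPoincare4.SmoothPoincare4.Cruxes.TameOrBrodyR4.Sketch
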